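import Literature.NumberTheory.Transcendental.KZSemiCanonicalReductionProofs
import Summits.KontsevichZagierPeriods.KontsevichZagierPeriods.Theorems.ValuedFieldSpecialisationClassLevelExpansionFibreDimOneToolkit

/-!
# Route ValuedFieldSpecialisation — crux `ParametricLifting` (stmt-KontsevichZagierPeriods-3498):
TIGHTNESS (a) — the fibredness of the change of variables is load-bearing

Helper (`--supports`) for item stmt-KontsevichZagierPeriods-3498 (line `registered`, lead c5). The crux
`ParametricLifting` (PL) asks, for rational representations `r`, `r'` with equal value, for a relation
`G = Σ mᵢ [Rᵢ]` in the subgroup generated by the FIBRED move generators — all instances of domain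
and integrand additivity, the changes of variables `Φ` with `Φ z 0 = z 0` on `(n+1)`-dimensional
representations, and the Newton–Leibniz moves over a base of dimension `≥ 1` — whose net is a
`ℤ`-combination of DOMINATED families (`KZ.IsDominatedFamily (R i) (r₀ i) (g i)`, the clauses of
(CT3)) with `Σ mᵢ [r₀ᵢ] − ([r] − [r']) ∈ KZ.relations`; its complement SF ("special fibres of
dominated fibred relations are relations") is what the route's thesis `CTConstruction` delivers
(`kontsevichZagierPeriods_iff_parametricLifting_and_specialFibre`: summit ⇔ PL ∧ SF).

This file certifies that the single clause `∀ x ∈ r.domain, Φ x 0 = x 0` in the third generator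
set is LOAD-BEARING — the kind of `_false_without_` fact the crux's disprover would have filed (no
`Disproof.lean` was ever written for this crux). Delete it, i.e. admit the changes of variables of
`(n+1)`-dimensional representations that move the parameter coordinate, and:

* `parametricLifting_unfibred_all_pairs` — the lifting property holds for EVERY pair of
  representations, of any dimensions, WITHOUT the rationality and equal-value hypotheses (so the
  relaxed crux is junk-inhabited and value-unsound): the constant family `r.cylinder = (0,1) × r`
  (dominated, special fibre `r`) and its translate by `2` in the parameter (domain in `{2 < z 0}`,
  hence vacuously dominated with EMPTY special fibre) differ by ONE change of variables
  `z ↦ z + 2e₀` — so `[r] − [∅] ≡ [r]` is a "special-fibre class" of a dominated net lying in the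
  relaxed subgroup, for every `r` (`exists_isDominatedFamily_empty_sub_mem_unfibred`); four such
  families handle a pair (`exists_net_append` concatenates dominated nets of arbitrary dimensions);
* `not_specialFibre_unfibred` — SF becomes FALSE: for the unit interval `c = ((0,1), 1)` the net
  `[c.cylinder] − [translate]` lies in the relaxed subgroup while its special-fibre class
  `[c] − [∅]` has value `1` (`not_specialFibre_relations`: a fortiori SF fails for `KZ.relations`
  in place of `KZ.fibredRelations`).

So inside route ValuedFieldSpecialisation the word "fibred" carries exactly the content that
separates PL from a triviality and SF from a falsity: fibred relations have vanishing SLICE values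
(`KZ.sliceEval_ae_eq_zero`), which is what makes special fibres value-sound
(`eval_specialFibre_eq_zero`); an unfibred change of variables only preserves the TOTAL integral.

No definition is introduced: the relaxed generator set is written out in the theorem types (it is
the third set inlined in the route declarations with the clause `Φ x 0 = x 0` removed).
Sources: M. Kontsevich, D. Zagier, *Periods* (2001), §1.2 (rules (1)–(3)); J. Ayoub, *Une version
relative de la conjecture des périodes de Kontsevich–Zagier*, Ann. Math. 181 (2015), §1 (rules
relative to a base). The fibred/dominated vocabulary is this route's (`KZFibredRelations.lean`,
`KZDominatedFamily.lean`).
-/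

noncomputable section

namespace Summit.KontsevichZagierPeriods.ValuedFieldSpecialisation

open MeasureTheory Set Filter MvPolynomial
open scoped Topology
open Literature.NumberTheory.Transcendental Literature.NumberTheory.Transcendental.KZ
open Literature.ModelTheory.ExponentialFields (IsSemialgebraic)

variable {n : ℕ}

/-! ### Translating the parameter of a family is an (unfibred) change of variables -/

/-- **Translation of the parameter.** For a family `R : IntegralRep (n + 1)` there is a
representation `R'` — the translate of `R` by `2` in the parameter coordinate `z 0`
(`KZ.exists_translate`) — whose domain lies in `{2 < z 0}` and such that `[R] − [R']` is an
instance of the change of variables `Φ z = z + 2e₀` (identity derivative, Jacobian `1`) between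
`(n+1)`-dimensional representations: an element of the third generator set of the crux WITH THE
FIBREDNESS CLAUSE `Φ z 0 = z 0` DELETED (of course `Φ z 0 = z 0 + 2 ≠ z 0`).
[Kontsevich–Zagier 2001, §1.2 rule (2)] [folklore] -/
theorem exists_translate_param_sub_mem_unfibred (R : IntegralRep (n + 1)) :
    ∃ R' : IntegralRep (n + 1), (∀ z ∈ R'.domain, ∃ y ∈ R.domain, y 0 = z 0 - 2) ∧
      of R - of R' ∈ {c | ∃ (n : ℕ) (r r' : IntegralRep (n + 1)) (Φ : (Fin (n + 1) → ℝ) → (Fin (n + 1) → ℝ)) (Φ' : (Fin (n + 1) → ℝ) → (Fin (n + 1) → ℝ) →L[ℝ] (Fin (n + 1) → ℝ)), IsSemialgebraicMapOn ℚ r.domain Φ ∧ (∀ x ∈ r.domain, HasFDerivWithinAt Φ (Φ' x) r.domain x) ∧ Set.InjOn Φ r.domain ∧ r'.domain = Φ '' r.domain ∧ (∀ x ∈ r.domain, r.integrand x = r'.integrand (Φ x) * |(Φ' x).det|) ∧ c = of r - of r'} := by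
  -- the translation vector `2 e₀`
  let v : Fin (n + 1) → ℚ := fun i => if i = 0 then 2 else 0
  set w : Fin (n + 1) → ℝ := fun i => (v i : ℝ) with hw
  have hw0 : w 0 = 2 := by simp [hw, v]
  obtain ⟨R', hd, hi, -⟩ := exists_translate R v
  refine ⟨R', fun z hz => ?_, ?_⟩
  · rw [hd] at hz
    exact ⟨z - w, hz, by simp [hw0]⟩
  -- the move, along `Φ x = x + w`
  have hpoly : ∀ x : Fin (n + 1) → ℝ,
      (fun j => aeval x (X j + C (v j) : MvPolynomial (Fin (n + 1)) ℚ)) = x + w := fun x => by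
    ext j
    simp [hw]
  refine ⟨n, R, R', fun x => x + w, fun _ => ContinuousLinearMap.id ℝ _, ?_, ?_, ?_, ?_, ?_, rfl⟩
  · exact (isSemialgebraicMapOn_aeval R.isSemialgebraic_domain
      fun j => (X j + C (v j) : MvPolynomial (Fin (n + 1)) ℚ)).congr fun x _ => hpoly x
  · exact fun x _ => ((hasFDerivAt_id x).add_const w).hasFDerivWithinAt
  · exact fun x _ y _ h => add_right_cancel h
  · rw [hd]
    exact preimage_sub_eq_image_add w R.domain
  · intro x _
    have hdet : (ContinuousLinearMap.id ℝ (Fin (n + 1) → ℝ)).det = 1 := by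
      rw [ContinuousLinearMap.det, ContinuousLinearMap.coe_id, LinearMap.det_id]
    simp [hi, hdet, hw]

/-- **The building block.** For every representation `r` (any dimension `n`) there is a family
`R'` which is DOMINATED WITH EMPTY SPECIAL FIBRE (its domain avoids the slab `{0 < z 0 < 1}`,
`isDominatedFamily_empty_of_forall_not`) and such that `[r.cylinder] − [R']` is one unfibred
change of variables (the parameter translate of the constant family `r.cylinder = (0,1) × r`,
`exists_translate_param_sub_mem_unfibred`). Since `r.cylinder` is dominated with special fibre `r`
(`KZ.IntegralRep.isDominatedFamily_cylinder`), the dominated net `[r.cylinder] − [R']` has the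
special-fibre class `[r] − [∅] ≡ [r]`. [Kontsevich–Zagier 2001, §1.2 rule (2)] [folklore] -/
theorem exists_isDominatedFamily_empty_sub_mem_unfibred (r : IntegralRep n) :
    ∃ R' : IntegralRep (n + 1), IsDominatedFamily R' (IntegralRep.empty n) (IntegralRep.empty n) ∧
      of r.cylinder - of R' ∈ {c | ∃ (n : ℕ) (r r' : IntegralRep (n + 1)) (Φ : (Fin (n + 1) → ℝ) → (Fin (n + 1) → ℝ)) (Φ' : (Fin (n + 1) → ℝ) → (Fin (n + 1) → ℝ) →L[ℝ] (Fin (n + 1) → ℝ)), IsSemialgebraicMapOn ℚ r.domain Φ ∧ (∀ x ∈ r.domain, HasFDerivWithinAt Φ (Φ' x) r.domain x) ∧ Set.InjOn Φ r.domain ∧ r'.domain = Φ '' r.domain ∧ (∀ x ∈ r.domain, r.integrand x = r'.integrand (Φ x) * |(Φ' x).det|) ∧ c = of r - of r'} := by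
  obtain ⟨R', hR', hmem⟩ := exists_translate_param_sub_mem_unfibred r.cylinder
  refine ⟨R', isDominatedFamily_empty_of_forall_not one_pos fun z hz h => ?_, hmem⟩
  obtain ⟨y, hy, hy0⟩ := hR' z hz
  rw [IntegralRep.domain_cylinder] at hy
  have hy1 : 0 < y 0 := hy.1
  have : z 0 < 1 := h.2
  linarith

/-! ### Concatenating dominated nets -/

/-- **Concatenation of dominated nets.** Two dominated nets `(mᵢ, Rᵢ → r₀ᵢ, gᵢ)_{i < k₁}` and
`(m'ⱼ, R'ⱼ → r'₀ⱼ, g'ⱼ)_{j < k₂}` of families of arbitrary (fibre) dimensions concatenate to a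
dominated net indexed by `Fin (k₁ + k₂)` whose net class and special-fibre class are the sums. The
dimensions being dependent on the index, the families are packed as points of
`Σ d, IntegralRep (d+1) × IntegralRep d × IntegralRep d` and appended with `Fin.append`;
`Fin.sum_univ_add`, `Fin.append_left/right`. [folklore] -/
theorem exists_net_append {k₁ k₂ : ℕ} {d₁ : Fin k₁ → ℕ} {d₂ : Fin k₂ → ℕ}
    (m₁ : Fin k₁ → ℤ) (m₂ : Fin k₂ → ℤ)
    (R₁ : (i : Fin k₁) → IntegralRep (d₁ i + 1)) (r₁ g₁ : (i : Fin k₁) → IntegralRep (d₁ i))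
    (R₂ : (i : Fin k₂) → IntegralRep (d₂ i + 1)) (r₂ g₂ : (i : Fin k₂) → IntegralRep (d₂ i))
    (h₁ : ∀ i, IsDominatedFamily (R₁ i) (r₁ i) (g₁ i))
    (h₂ : ∀ i, IsDominatedFamily (R₂ i) (r₂ i) (g₂ i)) :
    ∃ (d : Fin (k₁ + k₂) → ℕ) (m : Fin (k₁ + k₂) → ℤ)
      (R : (i : Fin (k₁ + k₂)) → IntegralRep (d i + 1))
      (r₀ g : (i : Fin (k₁ + k₂)) → IntegralRep (d i)),
      (∀ i, IsDominatedFamily (R i) (r₀ i) (g i)) ∧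
      (∑ i, m i • of (R i)) = (∑ i, m₁ i • of (R₁ i)) + ∑ i, m₂ i • of (R₂ i) ∧
      (∑ i, m i • of (r₀ i)) = (∑ i, m₁ i • of (r₁ i)) + ∑ i, m₂ i • of (r₂ i) := by
  let T₁ : Fin k₁ → Σ d : ℕ, IntegralRep (d + 1) × IntegralRep d × IntegralRep d :=
    fun i => ⟨d₁ i, R₁ i, r₁ i, g₁ i⟩
  let T₂ : Fin k₂ → Σ d : ℕ, IntegralRep (d + 1) × IntegralRep d × IntegralRep d :=
    fun i => ⟨d₂ i, R₂ i, r₂ i, g₂ i⟩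
  refine ⟨fun i => (Fin.append T₁ T₂ i).1, Fin.append m₁ m₂, fun i => (Fin.append T₁ T₂ i).2.1,
    fun i => (Fin.append T₁ T₂ i).2.2.1, fun i => (Fin.append T₁ T₂ i).2.2.2, ?_, ?_, ?_⟩
  · intro i
    refine Fin.addCases (fun i => ?_) (fun j => ?_) i
    · dsimp only
      rw [Fin.append_left]
      exact h₁ i
    · dsimp only
      rw [Fin.append_right]
      exact h₂ j
  · rw [Fin.sum_univ_add]
    congr 1
    · refine Finset.sum_congr rfl fun i _ => ?_
      dsimp only
      rw [Fin.append_left, Fin.append_left]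
    · refine Finset.sum_congr rfl fun j _ => ?_
      dsimp only
      rw [Fin.append_right, Fin.append_right]
  · rw [Fin.sum_univ_add]
    congr 1
    · refine Finset.sum_congr rfl fun i _ => ?_
      dsimp only
      rw [Fin.append_left, Fin.append_left]
    · refine Finset.sum_congr rfl fun j _ => ?_
      dsimp only
      rw [Fin.append_right, Fin.append_right]

/-! ### (a⁺) Without fibredness, every pair lifts -/

/-- **Unfibred lifting of an arbitrary pair** (closure form). For ANY two representations `r`,
`r'` (any dimensions; no rationality, no hypothesis on the values) there is `G` in the subgroup
generated by the changes of variables of `(n+1)`-dimensional representations WITHOUT the clause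
`Φ z 0 = z 0`, which is the net `[r.cylinder] − [T] − [r'.cylinder] + [T']` of four DOMINATED
families (`T`, `T'` the parameter translates, empty special fibres) whose special-fibre class is
`[r] − [∅] − [r'] + [∅] ≡ [r] − [r']` modulo `KZ.relations` (`KZ.IntegralRep.of_empty_mem_relations`).
[Kontsevich–Zagier 2001, §1.2] [folklore] -/
theorem parametricLifting_unfibred_all_pairs_closure :
    ∀ ⦃n n' : ℕ⦄ (r : IntegralRep n) (r' : IntegralRep n'),
      ∃ G ∈ AddSubgroup.closure {c | ∃ (n : ℕ) (r r' : IntegralRep (n + 1)) (Φ : (Fin (n + 1) → ℝ) → (Fin (n + 1) → ℝ)) (Φ' : (Fin (n + 1) → ℝ) → (Fin (n + 1) → ℝ) →L[ℝ] (Fin (n + 1) → ℝ)), IsSemialgebraicMapOn ℚ r.domain Φ ∧ (∀ x ∈ r.domain, HasFDerivWithinAt Φ (Φ' x) r.domain x) ∧ Set.InjOn Φ r.domain ∧ r'.domain = Φ '' r.domain ∧ (∀ x ∈ r.domain, r.integrand x = r'.integrand (Φ x) * |(Φ' x).det|) ∧ c = of r - of r'},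
        ∃ (k : ℕ) (d : Fin k → ℕ) (m : Fin k → ℤ) (R : (i : Fin k) → IntegralRep (d i + 1))
          (r₀ g : (i : Fin k) → IntegralRep (d i)),
          (∀ i, IsDominatedFamily (R i) (r₀ i) (g i)) ∧ G = ∑ i, m i • of (R i) ∧
          (∑ i, m i • of (r₀ i)) - (of r - of r') ∈ relations := by
  intro n n' r r'
  obtain ⟨T, hT, hmemT⟩ := exists_isDominatedFamily_empty_sub_mem_unfibred r
  obtain ⟨T', hT', hmemT'⟩ := exists_isDominatedFamily_empty_sub_mem_unfibred r'
  -- the two two-term nets and their concatenation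
  obtain ⟨d, m, R, r₀, g, hdom, hsumR, hsumr⟩ := exists_net_append
    (d₁ := fun _ : Fin 2 => n) (d₂ := fun _ : Fin 2 => n') ![1, -1] ![-1, 1]
    ![r.cylinder, T] ![r, IntegralRep.empty n] ![r.abs, IntegralRep.empty n]
    ![r'.cylinder, T'] ![r', IntegralRep.empty n'] ![r'.abs, IntegralRep.empty n']
    (by
      intro i
      fin_cases i
      · exact r.isDominatedFamily_cylinder
      · exact hT)
    (by
      intro i
      fin_cases i
      · exact r'.isDominatedFamily_cylinder
      · exact hT')
  refine ⟨∑ i, m i • of (R i), ?_, _, d, m, R, r₀, g, hdom, rfl, ?_⟩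
  · -- the net class `([r.cyl] − [T]) − ([r'.cyl] − [T'])` lies in the relaxed subgroup
    rw [hsumR]
    simp only [Fin.sum_univ_two, Matrix.cons_val_zero, Matrix.cons_val_one, one_zsmul, neg_zsmul]
    have h1 := AddSubgroup.subset_closure hmemT
    have h2 := AddSubgroup.subset_closure hmemT'
    have heq : of r.cylinder + -of T + (-of r'.cylinder + of T') =
        (of r.cylinder - of T) - (of r'.cylinder - of T') := by abel
    rw [heq]
    exact AddSubgroup.sub_mem _ h1 h2
  · -- the special-fibre class `([r] − [∅]) − ([r'] − [∅]) − ([r] − [r'])` is a relation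
    rw [hsumr]
    simp only [Fin.sum_univ_two, Matrix.cons_val_zero, Matrix.cons_val_one, one_zsmul, neg_zsmul]
    have heq : of r + -of (IntegralRep.empty n) + (-of r' + of (IntegralRep.empty n')) -
        (of r - of r') = of (IntegralRep.empty n') - of (IntegralRep.empty n) := by abel
    rw [heq]
    exact relations.sub_mem IntegralRep.of_empty_mem_relations IntegralRep.of_empty_mem_relations

/-- **Tightness (a⁺): `ParametricLifting` with the fibredness clause deleted holds for EVERY pair.**
Literally the crux `ParametricLifting` with (i) the clause `(∀ x ∈ r.domain, Φ x 0 = x 0)` removed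
from the third generator set and (ii) the hypotheses `r.IsRational → r'.IsRational →
r.value = r'.value` dropped: it holds for all pairs of representations of all dimensions — equal
values or not — so the relaxed statement is junk-inhabited and its "special-fibre classes" are not
even value-sound. The fibredness of the changes of variables is therefore exactly what gives the
crux its content. (`parametricLifting_unfibred_all_pairs_closure` + monotonicity of
`AddSubgroup.closure`.) [Kontsevich–Zagier 2001, §1.2; Ayoub 2015, §1] [folklore] -/
theorem parametricLifting_unfibred_all_pairs :
    ∀ ⦃n m : ℕ⦄ (r : Literature.NumberTheory.Transcendental.KZ.IntegralRep n) (r' : Literature.NumberTheory.Transcendental.KZ.IntegralRep m), ∃ G ∈ AddSubgroup.closure (Literature.NumberTheory.Transcendental.KZ.domainAddRel ∪ Literature.NumberTheory.Transcendental.KZ.integrandAddRel ∪ {c | ∃ (n : ℕ) (r r' : Literature.NumberTheory.Transcendental.KZ.IntegralRep (n + 1)) (Φ : (Fin (n + 1) → ℝ) → (Fin (n + 1) → ℝ)) (Φ' : (Fin (n + 1) → ℝ) → (Fin (n + 1) → ℝ) →L[ℝ] (Fin (n + 1) → ℝ)), Literature.NumberTheory.Transcendental.IsSemialgebraicMapOn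 ℚ r.domain Φ ∧ (∀ x ∈ r.domain, HasFDerivWithinAt Φ (Φ' x) r.domain x) ∧ Set.InjOn Φ r.domain ∧ r'.domain = Φ '' r.domain ∧ (∀ x ∈ r.domain, r.integrand x = r'.integrand (Φ x) * |(Φ' x).det|) ∧ c = Literature.NumberTheory.Transcendental.KZ.of r - Literature.NumberTheory.Transcendental.KZ.of r'} ∪ {c | c ∈ Literature.NumberTheory.Transcendental.KZ.newtonLeibnizRel ∧ ∃ (n : ℕ) (r : Literature.NumberTheory.Transcendental.KZ.IntegralRep (n + 2)) (r' : Literature.NumberTheory.Transcendental.KZ.IntegralRep (n + 1)), c = Literature.NumberTheory.Transcendental.KZ.of r - Literature.NumberTheory.Transcendental.KZ.of r'}), (∃ (k : ℕ) (d : Fin k → ℕ) (m : Fin k → ℤ) (R : (i : Fin k) → Literature.NumberTheory.Transcendental.KZ.IntegralRep (d i + 1)) (r₀ g : (i : Fin k) → Literature.NumberTheory.Transcendental.KZ.IntegralRep (d i)), (∀ i, ((∃ ε > (0 : ℝ), ∀ z ∈ (R i).domain, 0 < z 0 → z 0 < ε → (fun i : Fin (d i) => z i.succ) ∈ (g i).domain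 ∧ |(R i).integrand z| ≤ (g i).integrand (fun i : Fin (d i) => z i.succ)) ∧ (∀ᵐ x : Fin (d i) → ℝ, ∀ᶠ s in nhdsWithin (0 : ℝ) (Set.Ioi 0), (Matrix.vecCons s x ∈ (R i).domain ↔ x ∈ (r₀ i).domain)) ∧ (∀ᵐ x : Fin (d i) → ℝ, x ∈ (r₀ i).domain → Filter.Tendsto (fun s : ℝ => (R i).integrand (Matrix.vecCons s x)) (nhdsWithin 0 (Set.Ioi 0)) (nhds ((r₀ i).integrand x))))) ∧ G = ∑ i, m i • Literature.NumberTheory.Transcendental.KZ.of (R i) ∧ (∑ i, m i • Literature.NumberTheory.Transcendental.KZ.of (r₀ i)) - (Literature.NumberTheory.Transcendental.KZ.of r - Literature.NumberTheory.Transcendental.KZ.of r') ∈ Literature.NumberTheory.Transcendental.KZ.relations) := by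
  intro n n' r r'
  obtain ⟨G, hG, k, d, m, R, r₀, g, hdom, hGeq, hfib⟩ :=
    parametricLifting_unfibred_all_pairs_closure r r'
  refine ⟨G, AddSubgroup.closure_mono (fun c hc => ?_) hG, k, d, m, R, r₀, g,
    fun i => (isDominatedFamily_iff _ _ _).mp (hdom i), hGeq, hfib⟩
  exact Or.inl (Or.inr hc)

/-! ### (a⁻) Without fibredness, special fibres are not relations -/

/-- The open unit interval `{x : ℝ¹ | 0 < x 0 < 1}` is `ℚ`-semialgebraic and has volume `1`.
[folklore] -/
theorem isSemialgebraic_unitInterval_and_volume :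
    IsSemialgebraic ℚ {x : Fin 1 → ℝ | 0 < x 0 ∧ x 0 < 1} ∧
      volume {x : Fin 1 → ℝ | 0 < x 0 ∧ x 0 < 1} = 1 := by
  constructor
  · have h0 : IsSemialgebraic ℚ {x : Fin 1 → ℝ | 0 < x 0} := by
      simpa using Literature.ModelTheory.ExponentialFields.isSemialgebraic_setOf_eval_pos
        (k := ℚ) (R := ℝ) (X (0 : Fin 1))
    have h1 : IsSemialgebraic ℚ {x : Fin 1 → ℝ | x 0 < 1} := by
      simpa using Literature.ModelTheory.ExponentialFields.isSemialgebraic_setOf_eval_lt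
        (k := ℚ) (R := ℝ) (X (0 : Fin 1)) 1
    rw [Set.setOf_and]
    exact h0.inter h1
  · have hpi : {x : Fin 1 → ℝ | 0 < x 0 ∧ x 0 < 1} = Set.pi univ fun _ => Ioo (0 : ℝ) 1 := by
      ext x
      simp [Fin.forall_fin_one]
    rw [hpi, Real.volume_pi_Ioo]
    simp

/-- **Tightness (a⁻): without fibredness, SF is false.** It is NOT true that the special fibres of
a dominated net whose class lies in the subgroup generated by the UNFIBRED changes of variables of
families form a relation: for the unit interval `c = ((0,1), 1)` the net `[c.cylinder] − [T]`
(`T` the parameter translate) is one such change of variables, both families are dominated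
(special fibres `c` and `∅`), and the special-fibre class `[c] − [∅]` has `KZ.eval = 1 ≠ 0`, so it
is not in `KZ.relations` (`KZ.relations_le_ker_eval_holds`). Contrast: for FIBRED relations the
value shadow `eval_specialFibre_eq_zero` holds unconditionally. [Kontsevich–Zagier 2001, §1.2]
[folklore] -/
theorem not_specialFibre_unfibred :
    ¬ ∀ (k : ℕ) (d : Fin k → ℕ) (m : Fin k → ℤ) (R : (i : Fin k) → IntegralRep (d i + 1))
      (r₀ g : (i : Fin k) → IntegralRep (d i)), (∀ i, IsDominatedFamily (R i) (r₀ i) (g i)) →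
      (∑ i, m i • of (R i)) ∈ AddSubgroup.closure {c | ∃ (n : ℕ) (r r' : IntegralRep (n + 1)) (Φ : (Fin (n + 1) → ℝ) → (Fin (n + 1) → ℝ)) (Φ' : (Fin (n + 1) → ℝ) → (Fin (n + 1) → ℝ) →L[ℝ] (Fin (n + 1) → ℝ)), IsSemialgebraicMapOn ℚ r.domain Φ ∧ (∀ x ∈ r.domain, HasFDerivWithinAt Φ (Φ' x) r.domain x) ∧ Set.InjOn Φ r.domain ∧ r'.domain = Φ '' r.domain ∧ (∀ x ∈ r.domain, r.integrand x = r'.integrand (Φ x) * |(Φ' x).det|) ∧ c = of r - of r'} →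
      (∑ i, m i • of (r₀ i)) ∈ relations := by
  intro h
  obtain ⟨hsa, hvol⟩ := isSemialgebraic_unitInterval_and_volume
  obtain ⟨c, hcd, hci⟩ := exists_oneRep hsa (by rw [hvol]; exact ENNReal.one_ne_top)
  obtain ⟨T, hT, hmemT⟩ := exists_isDominatedFamily_empty_sub_mem_unfibred c
  have hdom : ∀ i : Fin 2, IsDominatedFamily ((![c.cylinder, T] : Fin 2 → IntegralRep (1 + 1)) i)
      ((![c, IntegralRep.empty 1] : Fin 2 → IntegralRep 1) i)
      ((![c.abs, IntegralRep.empty 1] : Fin 2 → IntegralRep 1) i) := by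
    intro i
    fin_cases i
    · exact c.isDominatedFamily_cylinder
    · exact hT
  have hnet := h 2 (fun _ => 1) ![1, -1] ![c.cylinder, T] ![c, IntegralRep.empty 1]
    ![c.abs, IntegralRep.empty 1] hdom (by
      simp only [Fin.sum_univ_two, Matrix.cons_val_zero, Matrix.cons_val_one, one_zsmul,
        neg_zsmul, ← sub_eq_add_neg]
      exact AddSubgroup.subset_closure hmemT)
  -- the special-fibre class `[c] − [∅]` has value `1`
  have hker := relations_le_ker_eval_holds hnet
  rw [AddMonoidHom.mem_ker] at hker
  simp only [Fin.sum_univ_two, Matrix.cons_val_zero, Matrix.cons_val_one, one_zsmul, neg_zsmul,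
    map_add, map_neg, eval_of, IntegralRep.value_empty, neg_zero, add_zero] at hker
  have hval : c.value = 1 := by
    rw [c.value_eq_volume_real (fun x _ => by simp [hci]), Measure.real, hcd, hvol,
      ENNReal.toReal_one]
  rw [hval] at hker
  exact one_ne_zero hker

/-- **Corollary: SF with `KZ.relations` in place of `KZ.fibredRelations` is false** — the
special fibres of a dominated net whose class is an honest (but not fibred) relation need not form
a relation (the relaxed subgroup of `not_specialFibre_unfibred` consists of change-of-variables
moves, `KZ.changeOfVariablesRel_subset_relations`). [Kontsevich–Zagier 2001, §1.2] [folklore] -/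
theorem not_specialFibre_relations :
    ¬ ∀ (k : ℕ) (d : Fin k → ℕ) (m : Fin k → ℤ) (R : (i : Fin k) → IntegralRep (d i + 1))
      (r₀ g : (i : Fin k) → IntegralRep (d i)), (∀ i, IsDominatedFamily (R i) (r₀ i) (g i)) →
      (∑ i, m i • of (R i)) ∈ relations → (∑ i, m i • of (r₀ i)) ∈ relations := by
  intro h
  refine not_specialFibre_unfibred fun k d m R r₀ g hdom hG => h k d m R r₀ g hdom ?_
  refine (AddSubgroup.closure_le _).mpr ?_ hG
  rintro c ⟨n, r, r', Φ, Φ', hΦ, hΦ', hinj, hdom, hf, rfl⟩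
  exact changeOfVariablesRel_subset_relations ⟨n + 1, r, r', Φ, Φ', hΦ, hΦ', hinj, hdom, hf, rfl⟩

end Summit.KontsevichZagierPeriods.ValuedFieldSpecialisation
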